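import Summits.KontsevichZagierPeriods.KontsevichZagierPeriods.Theses.FurushoPentagon
import Summits.KontsevichZagierPeriods.KontsevichZagierPeriods.Theorems.FurushoPentagonReducedPeriodRingLinStokesSymDefs
import Summits.KontsevichZagierPeriods.KontsevichZagierPeriods.Theorems.FurushoPentagonReducedPeriodRingSubdivGeneration
import Summits.KontsevichZagierPeriods.KontsevichZagierPeriods.Theorems.FurushoPentagonLinStokesSymCovDet
import Summits.KontsevichZagierPeriods.KontsevichZagierPeriods.Theorems.FurushoPentagonSectorToKernelStokesSpanCalibration
import Literature.NumberTheory.Transcendental.KZCubicalCalculus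
import Literature.NumberTheory.Transcendental.KZProductIdeal
import Literature.NumberTheory.Transcendental.SemialgebraicMapsProofs
import Literature.NumberTheory.Transcendental.SemialgebraicLineDeriv
import Mathlib.LinearAlgebra.Matrix.Adjugate
import Mathlib.Analysis.Calculus.Deriv.Mul
import Mathlib.Analysis.Calculus.Deriv.Add
import Mathlib.Analysis.Calculus.Deriv.Prod
import Mathlib.Analysis.Calculus.Deriv.Comp

/-!
# `ReducedPeriodRing`, line `lin-stokes-sym`: the homotopy forms of the change of variables

Helper file for the stub `stub_covGeneration` of crux `FurushoPentagon.ReducedPeriodRing`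
(stmt-KontsevichZagierPeriods-3929), line `lin-stokes-sym`. For a self-map `Φ` of the cube
`[0,1]ⁿ` with coordinates analytic near the cube and `ℚ`-semialgebraic on it, and a function `f`
analytic near the cube and `ℚ`-semialgebraic on it, the straight-line homotopy
`φ(x, y) = (1 − y)x + yΦ(x)` (`y ∈ [0,1]` a new LAST coordinate) pulls the volume form
`f(u) du₁ ∧ ⋯ ∧ duₙ` back to `B dx₁ ∧ ⋯ ∧ dxₙ + Σⱼ A_j dx₁ ∧ ⋯ (dy in slot j) ⋯ ∧ dxₙ` with
`B = f(φ)·det J`, `A_j = f(φ)·det J[col j ↦ v]`, `J = ∂ₓφ = (1 − y)I + yDΦ(x)`,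
`v = ∂_yφ = Φ(x) − x` (file-local notations `B[n, Φ, f]`, `A[n, Φ, f]`). This file proves:

* `sideConditions` — `B` and the `A_j` are analytic near `[0,1]ⁿ⁺¹` and `ℚ`-semialgebraic on it
  (partial derivatives of `Φ` are semialgebraic on the CLOSED cube in every coordinate,
  `CovGeneration.isSemialgebraicFunOn_fderiv_apply_single`);
* `volForm_snoc_zero`, `volForm_snoc_one` — `B(x, 0) = f(x)`, `B(x, 1) = f(Φ x)·det DΦ(x)`;
* `faceForm_snoc_eq_zero` — if `Φ` preserves the facets `{x_j = a}` (`a = 0, 1`) then `A_j`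
  vanishes on `{x_j = a}` (row `j` of `J[col j ↦ v]` vanishes there: `v_j = Φ_j − x_j = 0` and the
  tangential derivatives of `Φ_j` vanish).

The closedness identity `∂_y B = Σⱼ ∂ⱼ A_j` is `…LinStokesSymCovClosed`.

References: M. Kontsevich, D. Zagier, *Periods* (2001), §1.2 rule (2); J. Ayoub, *Periods and
the conjectures of Grothendieck and Kontsevich–Zagier*, EMS Newsl. 91 (2014), Def. 10;
J. Bochnak, M. Coste, M.-F. Roy, *Real Algebraic Geometry* (1998), Prop. 2.2.6.
-/

noncomputable section

namespace Summit.KontsevichZagierPeriods.FurushoPentagon.ReducedPeriodRing.LinStokesSym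

open Set MeasureTheory
open Literature.NumberTheory.Transcendental
open Literature.NumberTheory.Transcendental.KZ
open Summit.KontsevichZagierPeriods.FurushoPentagon.SectorToKernel

/-- The volume component `B(x, y) = f(φ(x,y))·det ∂ₓφ(x,y)` of the pulled-back form along the
straight-line homotopy `φ(x, y) = (1 − y)x + yΦ(x)` on `ℝⁿ⁺¹ ∋ (x, y)` (file-local notation). -/
local notation3 (prettyPrint := false) "B[" n ", " Φ ", " f "]" => fun w : Fin (n + 1) → ℝ =>
  f (fun i : Fin n => (1 - w (Fin.last n)) * w (Fin.castSucc i) + w (Fin.last n) * Φ (Fin.init w) i) *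
    (Matrix.of fun i k : Fin n => (1 - w (Fin.last n)) * (if i = k then (1 : ℝ) else 0) +
      w (Fin.last n) * fderiv ℝ (fun x => Φ x i) (Fin.init w) (Pi.single k 1)).det

/-- The face components `A_j(x, y) = f(φ(x,y))·det (∂ₓφ)[col j ↦ ∂_yφ](x,y)` of the pulled-back
form along the straight-line homotopy (file-local notation). -/
local notation3 (prettyPrint := false) "A[" n ", " Φ ", " f "]" =>
  fun (j : Fin n) (w : Fin (n + 1) → ℝ) =>
  f (fun i : Fin n => (1 - w (Fin.last n)) * w (Fin.castSucc i) + w (Fin.last n) * Φ (Fin.init w) i) *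
    ((Matrix.of fun i k : Fin n => (1 - w (Fin.last n)) * (if i = k then (1 : ℝ) else 0) +
      w (Fin.last n) * fderiv ℝ (fun x => Φ x i) (Fin.init w) (Pi.single k 1)).updateCol j
      (fun i : Fin n => Φ (Fin.init w) i - w (Fin.castSucc i))).det

namespace CovGeneration

open SubdivGeneration (analyticOnNhd_apply)

variable {n : ℕ} {Φ : (Fin n → ℝ) → (Fin n → ℝ)} {f : (Fin n → ℝ) → ℝ}
  {B : (Fin (n + 1) → ℝ) → ℝ} {A : Fin n → (Fin (n + 1) → ℝ) → ℝ}

/-- `B` on a slice `s ↦ (x, s)`. [folklore] -/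
theorem volForm_snoc (hB : B = B[n, Φ, f]) (x : Fin n → ℝ) (s : ℝ) :
    B (Fin.snoc x s) = f (fun i => (1 - s) * x i + s * Φ x i) *
      (Matrix.of fun i k : Fin n => (1 - s) * (if i = k then (1 : ℝ) else 0) +
        s * fderiv ℝ (fun z => Φ z i) x (Pi.single k 1)).det := by
  simp only [hB, Fin.init_snoc, Fin.snoc_last, Fin.snoc_castSucc]

/-- `A_j` at a point `(z, y)`. [folklore] -/
theorem faceForm_snoc (hA : A = A[n, Φ, f]) (j : Fin n) (z : Fin n → ℝ) (y : ℝ) :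
    A j (Fin.snoc z y) = f (fun i => (1 - y) * z i + y * Φ z i) *
      ((Matrix.of fun i k : Fin n => (1 - y) * (if i = k then (1 : ℝ) else 0) +
          y * fderiv ℝ (fun x => Φ x i) z (Pi.single k 1)).updateCol j
        (fun i => Φ z i - z i)).det := by
  simp only [hA, Fin.init_snoc, Fin.snoc_last, Fin.snoc_castSucc]

/-- **Side conditions.** For `Φ` with coordinates analytic near `[0,1]ⁿ` and `ℚ`-semialgebraic on
it, mapping the cube into itself, and `f` analytic near the cube and `ℚ`-semialgebraic on it, the
forms `B` and `A_j` are analytic near `[0,1]ⁿ⁺¹` and `ℚ`-semialgebraic on it: `φ` maps the cube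
into the cube (convexity), partial derivatives of the `Φᵢ` are semialgebraic on the closed cube,
and determinants are polynomials in the entries. [Bochnak–Coste–Roy 1998, Prop. 2.2.6] -/
theorem sideConditions (hΦa : ∀ i, AnalyticOnNhd ℝ (fun x => Φ x i) (cube n))
    (hΦs : ∀ i, IsSemialgebraicFunOn ℚ (cube n) (fun x => Φ x i))
    (hΦm : MapsTo Φ (cube n) (cube n))
    (hfa : AnalyticOnNhd ℝ f (cube n)) (hfs : IsSemialgebraicFunOn ℚ (cube n) f)
    (hB : B = B[n, Φ, f]) (hA : A = A[n, Φ, f]) :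
    (AnalyticOnNhd ℝ B (cube (n + 1)) ∧ IsSemialgebraicFunOn ℚ (cube (n + 1)) B) ∧
      ∀ j, AnalyticOnNhd ℝ (A j) (cube (n + 1)) ∧ IsSemialgebraicFunOn ℚ (cube (n + 1)) (A j) := by
  have hX : ∀ k : Fin (n + 1), AnalyticOnNhd ℝ (fun w : Fin (n + 1) → ℝ => w k) (cube (n + 1)) :=
    fun k => analyticOnNhd_apply _ k _
  have hXs : ∀ k : Fin (n + 1),
      IsSemialgebraicFunOn ℚ (cube (n + 1)) (fun w : Fin (n + 1) → ℝ => w k) :=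
    fun k => isSemialgebraicFunOn_apply isSemialgebraic_cube k
  have h1s : IsSemialgebraicFunOn ℚ (cube (n + 1)) (fun _ : Fin (n + 1) → ℝ => (1 : ℝ)) := by
    simpa using isSemialgebraicFunOn_ratCast (isSemialgebraic_cube (n := n + 1)) 1
  have h0s : IsSemialgebraicFunOn ℚ (cube (n + 1)) (fun _ : Fin (n + 1) → ℝ => (0 : ℝ)) := by
    simpa using isSemialgebraicFunOn_ratCast (isSemialgebraic_cube (n := n + 1)) 0
  have hinit : MapsTo (fun w : Fin (n + 1) → ℝ => Fin.init w) (cube (n + 1)) (cube n) :=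
    fun w hw j => hw (Fin.castSucc j)
  -- `Φ ∘ init` and the pulled-back partial derivatives of `Φ`
  have hΦIa : ∀ i, AnalyticOnNhd ℝ (fun w : Fin (n + 1) → ℝ => Φ (Fin.init w) i) (cube (n + 1)) :=
    fun i => (hΦa i).comp (AnalyticOnNhd.pi fun j => hX (Fin.castSucc j)) hinit
  have hΦIs : ∀ i, IsSemialgebraicFunOn ℚ (cube (n + 1))
      (fun w : Fin (n + 1) → ℝ => Φ (Fin.init w) i) :=
    fun i => (hΦs i).comp_init_mono isSemialgebraic_cube hinit
  have hPa : ∀ i k, AnalyticOnNhd ℝ (fun w : Fin (n + 1) → ℝ =>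
      fderiv ℝ (fun x => Φ x i) (Fin.init w) (Pi.single k 1)) (cube (n + 1)) :=
    fun i k => (stokesCal_analyticOnNhd_fderiv_apply (hΦa i) (Pi.single k 1)).comp
      (AnalyticOnNhd.pi fun j => hX (Fin.castSucc j)) hinit
  have hPs : ∀ i k, IsSemialgebraicFunOn ℚ (cube (n + 1)) (fun w : Fin (n + 1) → ℝ =>
      fderiv ℝ (fun x => Φ x i) (Fin.init w) (Pi.single k 1)) :=
    fun i k => (isSemialgebraicFunOn_fderiv_apply_single (hΦa i) (hΦs i) k).comp_init_mono
      isSemialgebraic_cube hinit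
  -- the homotopy `φ` maps the cube into the cube; `F = f ∘ φ`
  have hφa : ∀ i, AnalyticOnNhd ℝ (fun w : Fin (n + 1) → ℝ =>
      (1 - w (Fin.last n)) * w (Fin.castSucc i) + w (Fin.last n) * Φ (Fin.init w) i)
      (cube (n + 1)) :=
    fun i => ((analyticOnNhd_const.sub (hX _)).mul (hX _)).add ((hX _).mul (hΦIa i))
  have hφs : ∀ i, IsSemialgebraicFunOn ℚ (cube (n + 1)) (fun w : Fin (n + 1) → ℝ =>
      (1 - w (Fin.last n)) * w (Fin.castSucc i) + w (Fin.last n) * Φ (Fin.init w) i) :=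
    fun i => ((h1s.fun_sub (hXs _)).fun_mul (hXs _)).fun_add ((hXs _).fun_mul (hΦIs i))
  have hφm : MapsTo (fun w : Fin (n + 1) → ℝ => fun i : Fin n =>
      (1 - w (Fin.last n)) * w (Fin.castSucc i) + w (Fin.last n) * Φ (Fin.init w) i)
      (cube (n + 1)) (cube n) := by
    intro w hw i
    have hy := hw (Fin.last n)
    have hx := hw (Fin.castSucc i)
    have hΦ := hΦm (hinit hw) i
    constructor <;> nlinarith [hy.1, hy.2, hx.1, hx.2, hΦ.1, hΦ.2]
  have hFa : AnalyticOnNhd ℝ (fun w : Fin (n + 1) → ℝ => f (fun i : Fin n =>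
      (1 - w (Fin.last n)) * w (Fin.castSucc i) + w (Fin.last n) * Φ (Fin.init w) i))
      (cube (n + 1)) :=
    hfa.comp (AnalyticOnNhd.pi fun i => hφa i) hφm
  have hFs : IsSemialgebraicFunOn ℚ (cube (n + 1)) (fun w : Fin (n + 1) → ℝ => f (fun i : Fin n =>
      (1 - w (Fin.last n)) * w (Fin.castSucc i) + w (Fin.last n) * Φ (Fin.init w) i)) :=
    IsSemialgebraicFunOn.comp_isSemialgebraicMapOn_holds hfs
      (IsSemialgebraicMapOn.of_forall isSemialgebraic_cube fun i => hφs i) hφm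
  -- entries of `J` and `v`
  have hδs : ∀ i k : Fin n, IsSemialgebraicFunOn ℚ (cube (n + 1))
      (fun _ : Fin (n + 1) → ℝ => if i = k then (1 : ℝ) else 0) := by
    intro i k
    by_cases hik : i = k
    · simp only [hik, if_true]; exact h1s
    · simp only [hik, if_false]; exact h0s
  have hJa : ∀ i k, AnalyticOnNhd ℝ (fun w : Fin (n + 1) → ℝ =>
      (1 - w (Fin.last n)) * (if i = k then (1 : ℝ) else 0) +
        w (Fin.last n) * fderiv ℝ (fun x => Φ x i) (Fin.init w) (Pi.single k 1)) (cube (n + 1)) :=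
    fun i k => ((analyticOnNhd_const.sub (hX _)).mul analyticOnNhd_const).add ((hX _).mul (hPa i k))
  have hJs : ∀ i k, IsSemialgebraicFunOn ℚ (cube (n + 1)) (fun w : Fin (n + 1) → ℝ =>
      (1 - w (Fin.last n)) * (if i = k then (1 : ℝ) else 0) +
        w (Fin.last n) * fderiv ℝ (fun x => Φ x i) (Fin.init w) (Pi.single k 1)) :=
    fun i k => ((h1s.fun_sub (hXs _)).fun_mul (hδs i k)).fun_add ((hXs _).fun_mul (hPs i k))
  have hva : ∀ i, AnalyticOnNhd ℝ
      (fun w : Fin (n + 1) → ℝ => Φ (Fin.init w) i - w (Fin.castSucc i)) (cube (n + 1)) :=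
    fun i => (hΦIa i).sub (hX _)
  have hvs : ∀ i, IsSemialgebraicFunOn ℚ (cube (n + 1))
      (fun w : Fin (n + 1) → ℝ => Φ (Fin.init w) i - w (Fin.castSucc i)) :=
    fun i => (hΦIs i).fun_sub (hXs _)
  subst hB hA
  refine ⟨⟨hFa.mul (analyticOnNhd_matrix_det fun i k => hJa i k),
    hFs.fun_mul (IsSemialgebraicFunOn.matrix_det isSemialgebraic_cube fun i k => hJs i k)⟩,
    fun j => ⟨hFa.mul (analyticOnNhd_matrix_det fun i k => ?_),
      hFs.fun_mul (IsSemialgebraicFunOn.matrix_det isSemialgebraic_cube fun i k => ?_)⟩⟩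
  · by_cases hk : k = j
    · simp only [Matrix.updateCol_apply, hk, if_true]; exact hva i
    · simp only [Matrix.updateCol_apply, hk, if_false, Matrix.of_apply]; exact hJa i k
  · by_cases hk : k = j
    · simp only [Matrix.updateCol_apply, hk, if_true]; exact hvs i
    · simp only [Matrix.updateCol_apply, hk, if_false, Matrix.of_apply]; exact hJs i k

/-- `B(x, 0) = f(x)` (`φ(x, 0) = x`, `J(x, 0) = I`). [folklore] -/
theorem volForm_snoc_zero (hB : B = B[n, Φ, f]) (x : Fin n → ℝ) : B (Fin.snoc x 0) = f x := by
  rw [volForm_snoc hB]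
  have h1 : (fun i => (1 - 0) * x i + 0 * Φ x i) = x := funext fun i => by ring
  have h2 : (Matrix.of fun i k : Fin n => (1 - 0) * (if i = k then (1 : ℝ) else 0) +
      0 * fderiv ℝ (fun z => Φ z i) x (Pi.single k 1)) = 1 := by
    ext i k
    simp [Matrix.one_apply]
  rw [h1, h2, Matrix.det_one, mul_one]

/-- `B(x, 1) = f(Φ x)·det DΦ(x)` (`φ(x, 1) = Φ(x)`, `J(x, 1) = DΦ(x)`). [folklore] -/
theorem volForm_snoc_one (hB : B = B[n, Φ, f]) {x : Fin n → ℝ}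
    (hΦd : ∀ i, DifferentiableAt ℝ (fun z => Φ z i) x) :
    B (Fin.snoc x 1) = f (Φ x) * (fderiv ℝ Φ x).det := by
  rw [volForm_snoc hB]
  have h1 : (fun i => (1 - 1) * x i + 1 * Φ x i) = Φ x := funext fun i => by ring
  have h2 : (Matrix.of fun i k : Fin n => (1 - 1) * (if i = k then (1 : ℝ) else 0) +
      1 * fderiv ℝ (fun z => Φ z i) x (Pi.single k 1)) =
      Matrix.of fun i k : Fin n => fderiv ℝ (fun z => Φ z i) x (Pi.single k 1) := by
    ext i k
    simp
  rw [h1, h2, det_of_fderiv_comp_apply hΦd]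

/-- **The face components vanish on their faces.** If `Φ_j ≡ a` on the facet `{x_j = a}` of the
cube then `A_j(z, y) = 0` for `z` in that facet: row `j` of `J[col j ↦ v]` is
`((1 − y)δ_{jk} + y ∂_kΦ_j)_{k ≠ j}, Φ_j − z_j) = 0` (tangential derivatives of a function constant
on the facet vanish). [folklore] -/
theorem faceForm_snoc_eq_zero (hA : A = A[n, Φ, f]) {j : Fin n} {a : ℝ}
    (hface : ∀ x ∈ cube n, x j = a → Φ x j = a)
    (hΦd : ∀ x ∈ cube n, DifferentiableAt ℝ (fun z => Φ z j) x)
    {z : Fin n → ℝ} (hz : z ∈ cube n) (hzj : z j = a) (y : ℝ) :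
    A j (Fin.snoc z y) = 0 := by
  rw [faceForm_snoc hA]
  refine mul_eq_zero_of_right _ (Matrix.det_eq_zero_of_row_eq_zero j fun k => ?_)
  rw [Matrix.updateCol_apply]
  by_cases hk : k = j
  · rw [if_pos hk, hface z hz hzj, hzj, sub_self]
  · rw [if_neg hk, Matrix.of_apply,
      fderiv_apply_single_eq_zero_of_eqOn_face hz hk hzj hface (hΦd z hz)]
    have hjk : (j : Fin n) ≠ k := fun h => hk h.symm
    simp [hjk]

/-- The face components vanish at both ends of the transposed slices: for `x ∈ [0,1]ⁿ` and
`a ∈ {0, 1}`, `A_j((x with x_j ↦ a), x_j) = 0`. [folklore] -/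
theorem faceForm_snoc_update_eq_zero (hA : A = A[n, Φ, f]) {j : Fin n}
    (hface0 : ∀ x ∈ cube n, x j = 0 → Φ x j = 0) (hface1 : ∀ x ∈ cube n, x j = 1 → Φ x j = 1)
    (hΦd : ∀ x ∈ cube n, DifferentiableAt ℝ (fun z => Φ z j) x) {x : Fin n → ℝ}
    (hx : x ∈ cube n) :
    A j (Fin.snoc (Function.update x j 1) (x j)) = 0 ∧
      A j (Fin.snoc (Function.update x j 0) (x j)) = 0 :=
  ⟨faceForm_snoc_eq_zero hA hface1 hΦd (update_mem_cube hx j zero_le_one le_rfl) (by simp) _,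
    faceForm_snoc_eq_zero hA hface0 hΦd (update_mem_cube hx j le_rfl zero_le_one) (by simp) _⟩

/-- Anchor of this helper file (registered sub-goal `stub_covGeneration_homotopy` of crux
stmt-KontsevichZagierPeriods-3929, serving `stub_covGeneration` of line `lin-stokes-sym`): the
volume component of the pulled-back form restricts to `f` on the bottom face `y = 0`
(`volForm_snoc_zero`). [folklore] -/
theorem stub_covGeneration_homotopy : ∀ (n : ℕ) (Φ : (Fin n → ℝ) → (Fin n → ℝ)) (f : (Fin n → ℝ) → ℝ) (x : Fin n → ℝ), (fun w : Fin (n + 1) → ℝ => f (fun i : Fin n => (1 - w (Fin.last n)) * w (Fin.castSucc i) + w (Fin.last n) * Φ (Fin.init w) i) * (Matrix.of fun i k : Fin n => (1 - w (Fin.last n)) * (if i = k then (1 : ℝ) else 0) + w (Fin.last n) * fderiv ℝ (fun z => Φ z i) (Fin.init w) (Pi.single k 1)).det) (Fin.snoc x 0) = f x :=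
  fun n Φ f x => volForm_snoc_zero (B := B[n, Φ, f]) rfl x

end CovGeneration

end Summit.KontsevichZagierPeriods.FurushoPentagon.ReducedPeriodRing.LinStokesSym
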